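import Summits.AtomisticToContinuum.Crystallization.Theorems.FrustratedLawDichotomyTwoShellRigidityLsLedgerFrame

/-!
# FrustratedLawDichotomy · two-shell rigidity — the CAP BRACE, part A/3: algebra of the octahedral cell
# (decomp-a2c, lens 3 «one certified translation + split beneath», gen 35; beneath slot 3 of `OverbindingBudgetTwoShellShape`)

Part A of three (A = this file: the two `ℝ³` facts and the real-arithmetic lemmas; B = `…TwoShellRigidityCapBraceCell`: the octahedral brace
lemma `octaBrace`; C = `…TwoShellRigidityCapBrace`: `CapBrace (7θ/2) θ Pat` for fcc/hcp and the brace-discharged entry arrows).  The whole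
story is told in part C's header; in short, `CapBrace β θ Pat` (`…TwoShellRigidityLsEntry`) is the last analytic hypothesis of the landed
ls-gauged entry arrows `lsEntryAt_fcc/hcp_of_sphericalLsFit` (`…TwoShellRigidityLsLedgerArrow`), and parts A–C prove it at `β = 7θ/2`,
`0 < θ ≤ 1/100`.

THIS FILE: for `ν = m × n`, `D = ‖ν‖² = ‖m‖²‖n‖² − ⟪m,n⟫²`, the in-plane Gram identity
`D‖v‖² − ⟪v,ν⟫² = ⟪v,m⟫²‖n‖² + ⟪v,n⟫²‖m‖² − 2⟪v,m⟫⟪v,n⟫⟪m,n⟫` (`inplane_identity`) and Cauchy–Schwarz for the projected pairing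
`Ẽ(v,w) = D⟪v,w⟫ − ⟪v,ν⟫⟪w,ν⟫` (`proj_cs`); the in-plane bound `inplane_le` (`Ẽ(v,v) ≤ A·D` from first-order bounds on `⟪v,m⟫, ⟪v,n⟫, ⟪m,n⟫`);
the second-order defect bound `delta_bound` (eliminating the normal components is ONE ring identity
`Q²·D·Δ = D(A−B)(QP − Q²) + QP·[(DB−QR) − (DA−QP)] + Q²·[(D·pp−P²) − (Dg−PR)]`); window bookkeeping `sq_win`, `excess_le`; and the exact
rational certificates `num_q`, `num_p` of the side conditions at `0 < t ≤ 1/100`.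

`[folklore]` elementary; no definitions, no `sorry`, no `instance`/`notation`.
-/

noncomputable section

namespace Summit.AtomisticToContinuum.Crystallization.Theorems.FrustratedLawDichotomyTwoShellRigidityCapBrace

open Literature.Geometry.DiscreteGeometry
open Summit.AtomisticToContinuum.Crystallization.Theorems.FrustratedLawDichotomyTwoShellRigidityCut
open Summit.AtomisticToContinuum.Crystallization.Theorems.FrustratedLawDichotomyTwoShellRigidityLsLedger
  (cross cross_apply_zero cross_apply_one cross_apply_two norm_cross_sq)
open scoped RealInnerProductSpace

/-! ## §1 Two facts of `ℝ³`: the in-plane Gram identity and Cauchy–Schwarz for the projected pairing -/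

/-- **In-plane Gram identity**: for `ν = m × n` and `D = ‖m‖²‖n‖² − ⟪m,n⟫² (= ‖ν‖²)`,
`D‖v‖² − ⟪v,ν⟫² = ⟪v,m⟫²‖n‖² + ⟪v,n⟫²‖m‖² − 2⟪v,m⟫⟪v,n⟫⟪m,n⟫` (the Gram determinant of `v` against the basis `m, n` of the plane `ν^⊥`).
[folklore] -/
theorem inplane_identity (m n v : E3) :
    (‖m‖ ^ 2 * ‖n‖ ^ 2 - ⟪m, n⟫ ^ 2) * ‖v‖ ^ 2 - ⟪v, cross m n⟫ ^ 2 =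
      ⟪v, m⟫ ^ 2 * ‖n‖ ^ 2 + ⟪v, n⟫ ^ 2 * ‖m‖ ^ 2 - 2 * ⟪v, m⟫ * ⟪v, n⟫ * ⟪m, n⟫ := by
  simp only [norm_sq_fin3, inner_fin3, cross_apply_zero, cross_apply_one, cross_apply_two]
  ring

/-- **Cauchy–Schwarz for the projected pairing** `Ẽ(v,w) = ‖ν‖²⟪v,w⟫ − ⟪v,ν⟫⟪w,ν⟫` (`= ⟪πv, πw⟫/‖ν‖²` for the scaled orthogonal projection
`π = ‖ν‖²·1 − ν⟪ν,·⟫` onto `ν^⊥`): `Ẽ(v,w)² ≤ Ẽ(v,v)·Ẽ(w,w)`. [folklore] -/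
theorem proj_cs {ν : E3} (v w : E3) (hD : 0 < ‖ν‖ ^ 2) :
    (‖ν‖ ^ 2 * ⟪v, w⟫ - ⟪v, ν⟫ * ⟪w, ν⟫) ^ 2 ≤
      (‖ν‖ ^ 2 * ‖v‖ ^ 2 - ⟪v, ν⟫ ^ 2) * (‖ν‖ ^ 2 * ‖w‖ ^ 2 - ⟪w, ν⟫ ^ 2) := by
  have hνν : ⟪ν, ν⟫ = ‖ν‖ ^ 2 := real_inner_self_eq_norm_sq ν
  have hvv : ⟪v, v⟫ = ‖v‖ ^ 2 := real_inner_self_eq_norm_sq v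
  have hww : ⟪w, w⟫ = ‖w‖ ^ 2 := real_inner_self_eq_norm_sq w
  have hνv : ⟪ν, v⟫ = ⟪v, ν⟫ := real_inner_comm v ν
  have hνw : ⟪ν, w⟫ = ⟪w, ν⟫ := real_inner_comm w ν
  have h1 : ⟪(‖ν‖ ^ 2) • v - ⟪v, ν⟫ • ν, (‖ν‖ ^ 2) • w - ⟪w, ν⟫ • ν⟫ =
      ‖ν‖ ^ 2 * (‖ν‖ ^ 2 * ⟪v, w⟫ - ⟪v, ν⟫ * ⟪w, ν⟫) := by
    simp only [inner_sub_left, inner_sub_right, real_inner_smul_left, real_inner_smul_right, hνν, hνw]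
    ring
  have h2 : ⟪(‖ν‖ ^ 2) • v - ⟪v, ν⟫ • ν, (‖ν‖ ^ 2) • v - ⟪v, ν⟫ • ν⟫ = ‖ν‖ ^ 2 * (‖ν‖ ^ 2 * ‖v‖ ^ 2 - ⟪v, ν⟫ ^ 2) := by
    simp only [inner_sub_left, inner_sub_right, real_inner_smul_left, real_inner_smul_right, hνν, hνv, hvv]
    ring
  have h3 : ⟪(‖ν‖ ^ 2) • w - ⟪w, ν⟫ • ν, (‖ν‖ ^ 2) • w - ⟪w, ν⟫ • ν⟫ = ‖ν‖ ^ 2 * (‖ν‖ ^ 2 * ‖w‖ ^ 2 - ⟪w, ν⟫ ^ 2) := by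
    simp only [inner_sub_left, inner_sub_right, real_inner_smul_left, real_inner_smul_right, hνν, hνw, hww]
    ring
  have hcs := real_inner_mul_inner_self_le ((‖ν‖ ^ 2) • v - ⟪v, ν⟫ • ν) ((‖ν‖ ^ 2) • w - ⟪w, ν⟫ • ν)
  rw [h1, h2, h3] at hcs
  have h4 : ‖ν‖ ^ 2 * ‖ν‖ ^ 2 * (‖ν‖ ^ 2 * ⟪v, w⟫ - ⟪v, ν⟫ * ⟪w, ν⟫) ^ 2 ≤
      ‖ν‖ ^ 2 * ‖ν‖ ^ 2 * ((‖ν‖ ^ 2 * ‖v‖ ^ 2 - ⟪v, ν⟫ ^ 2) * (‖ν‖ ^ 2 * ‖w‖ ^ 2 - ⟪w, ν⟫ ^ 2)) := by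
    have e1 : ‖ν‖ ^ 2 * ‖ν‖ ^ 2 * (‖ν‖ ^ 2 * ⟪v, w⟫ - ⟪v, ν⟫ * ⟪w, ν⟫) ^ 2 =
        ‖ν‖ ^ 2 * (‖ν‖ ^ 2 * ⟪v, w⟫ - ⟪v, ν⟫ * ⟪w, ν⟫) * (‖ν‖ ^ 2 * (‖ν‖ ^ 2 * ⟪v, w⟫ - ⟪v, ν⟫ * ⟪w, ν⟫)) := by ring
    have e2 : ‖ν‖ ^ 2 * ‖ν‖ ^ 2 * ((‖ν‖ ^ 2 * ‖v‖ ^ 2 - ⟪v, ν⟫ ^ 2) * (‖ν‖ ^ 2 * ‖w‖ ^ 2 - ⟪w, ν⟫ ^ 2)) =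
        ‖ν‖ ^ 2 * (‖ν‖ ^ 2 * ‖v‖ ^ 2 - ⟪v, ν⟫ ^ 2) * (‖ν‖ ^ 2 * (‖ν‖ ^ 2 * ‖w‖ ^ 2 - ⟪w, ν⟫ ^ 2)) := by ring
    rw [e1, e2]
    exact hcs
  exact le_of_mul_le_mul_left h4 (mul_pos hD hD)

/-! ## §2 Real arithmetic: the in-plane bound, the second-order defect, window bookkeeping -/

/-- **The in-plane bound**: if `|α| ≤ a`, `|β| ≤ a'`, `|γ| ≤ K`, `M, N ≥ L`, and the numbers satisfy `a², a'² ≤ A·L`,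
`(a·a' + A·K)² ≤ (A·L − a²)(A·L − a'²)`, then `α²N + β²M − 2αβγ ≤ A·(MN − γ²)` — i.e. `Ẽ(v,v) ≤ A·D` for a vector `v` with
`⟪v,m⟫ = α`, `⟪v,n⟫ = β`, `⟪m,n⟫ = γ`, `‖m‖² = M`, `‖n‖² = N`.  (Key identity: `A·(A·D − Ẽ) = (AM − α²)(AN − β²) − (αβ − Aγ)²`.) [folklore] -/
theorem inplane_le {α β γ M N a a' K L A : ℝ} (hA : 0 < A)
    (hM : L ≤ M) (hN : L ≤ N) (hα : |α| ≤ a) (hβ : |β| ≤ a') (hγ : |γ| ≤ K)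
    (haL : a ^ 2 ≤ A * L) (haL' : a' ^ 2 ≤ A * L) (hc : (a * a' + A * K) ^ 2 ≤ (A * L - a ^ 2) * (A * L - a' ^ 2)) :
    α ^ 2 * N + β ^ 2 * M - 2 * α * β * γ ≤ A * (M * N - γ ^ 2) := by
  have hα2 : α ^ 2 ≤ a ^ 2 := sq_le_sq' (abs_le.mp hα).1 (abs_le.mp hα).2
  have hβ2 : β ^ 2 ≤ a' ^ 2 := sq_le_sq' (abs_le.mp hβ).1 (abs_le.mp hβ).2
  have h1 : A * L - a ^ 2 ≤ A * M - α ^ 2 := by linarith [mul_le_mul_of_nonneg_left hM hA.le]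
  have h2 : A * L - a' ^ 2 ≤ A * N - β ^ 2 := by linarith [mul_le_mul_of_nonneg_left hN hA.le]
  have h3 : |α * β - A * γ| ≤ a * a' + A * K := by
    have e : α * β - A * γ = α * β + -(A * γ) + 0 := by ring
    rw [e]
    refine (abs_add_three _ _ _).trans ?_
    rw [abs_neg, abs_zero, add_zero, abs_mul A γ, abs_of_pos hA]
    exact add_le_add (by rw [abs_mul]; exact mul_le_mul hα hβ (abs_nonneg _) ((abs_nonneg _).trans hα))
      (mul_le_mul_of_nonneg_left hγ hA.le)
  have h4 : (α * β - A * γ) ^ 2 ≤ (a * a' + A * K) ^ 2 := sq_le_sq' (abs_le.mp h3).1 (abs_le.mp h3).2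
  have h5 : (A * L - a ^ 2) * (A * L - a' ^ 2) ≤ (A * M - α ^ 2) * (A * N - β ^ 2) :=
    mul_le_mul h1 h2 (by linarith) (by linarith [h1])
  have key : A * (A * (M * N - γ ^ 2) - (α ^ 2 * N + β ^ 2 * M - 2 * α * β * γ)) =
      (A * M - α ^ 2) * (A * N - β ^ 2) - (α * β - A * γ) ^ 2 := by ring
  have h6 : 0 ≤ A * (A * (M * N - γ ^ 2) - (α ^ 2 * N + β ^ 2 * M - 2 * α * β * γ)) := by
    rw [key]; linarith
  by_contra hcon
  have h7 : A * (A * (M * N - γ ^ 2) - (α ^ 2 * N + β ^ 2 * M - 2 * α * β * γ)) < 0 :=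
    mul_neg_of_pos_of_neg hA (by linarith)
  linarith

/-- **The second-order defect.**  For reals with `D > 0` («`‖ν‖²`»), `z ≥ d2 > 0` («`‖q‖² ≥ nn_O²`»), `|A − z|, |B − z| ≤ (103/50)·t·d2`
(«`κ_b, κ_c`»), the five projected pairings small — `|D·A − Q·P| ≤ 15t²·d2·D`, `0 ≤ D·z − Q² ≤ 9t²·d2·D`,
`|(D·B − Q·R) − (D·A − Q·P)| ≤ 9t²·d2·D`, `|(D·pp − P²) − (D·g − P·R)| ≤ 15t²·d2·D` — and `0 < t ≤ 1/100`:
`|pp − g − A + B| ≤ (2/5)·t·d2`.  (Eliminating `P, Q, R`: `Q²·D·Δ = D(A−B)(QP − Q²) + QP·[(DB−QR) − (DA−QP)] + Q²·[(D·pp−P²) − (Dg−PR)]`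
is a ring identity, and `Q² ≥ D(z − 9t²d2)`.) [folklore] -/
theorem delta_bound {t d2 D A B g z pp P Q R : ℝ} (ht0 : 0 < t) (ht : t ≤ 1 / 100) (hd : 0 < d2) (hD : 0 < D)
    (hz : d2 ≤ z) (hA : |A - z| ≤ 103 / 50 * t * d2) (hB : |B - z| ≤ 103 / 50 * t * d2)
    (he1 : |D * A - Q * P| ≤ 15 * t ^ 2 * d2 * D) (he4 : D * z - Q ^ 2 ≤ 9 * t ^ 2 * d2 * D) (he4' : Q ^ 2 ≤ D * z)
    (he21 : |(D * B - Q * R) - (D * A - Q * P)| ≤ 9 * t ^ 2 * d2 * D)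
    (he53 : |(D * pp - P ^ 2) - (D * g - P * R)| ≤ 15 * t ^ 2 * d2 * D) :
    |pp - g - A + B| ≤ 2 / 5 * t * d2 := by
  have htd : 0 < t * d2 := mul_pos ht0 hd
  have ht2 : t ^ 2 ≤ 1 / 100 * t := by rw [pow_two]; linarith [mul_le_mul_of_nonneg_left ht ht0.le]
  have ht2d : t ^ 2 * d2 ≤ 1 / 100 * t * d2 := by
    have := mul_le_mul_of_nonneg_right ht2 hd.le; linarith
  have htd' : t * d2 ≤ 1 / 100 * d2 := by
    have := mul_le_mul_of_nonneg_right ht hd.le; linarith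
  have hid : Q ^ 2 * D * (pp - g - A + B) =
      D * (A - B) * (Q * P - Q ^ 2) + Q * P * ((D * B - Q * R) - (D * A - Q * P)) +
        Q ^ 2 * ((D * pp - P ^ 2) - (D * g - P * R)) := by ring
  have hQ2 : D * (z - 9 * t ^ 2 * d2) ≤ Q ^ 2 := by linarith
  have hz9 : 0 < z - 9 * t ^ 2 * d2 := by linarith
  have hQpos : 0 < Q ^ 2 := lt_of_lt_of_le (mul_pos hD hz9) hQ2
  have hAz := abs_le.1 hA
  have hBz := abs_le.1 hB
  have he1' := abs_le.1 he1
  have hDA1 : D * (A - z) ≤ D * (103 / 50 * t * d2) := mul_le_mul_of_nonneg_left hAz.2 hD.le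
  have hDA2 : D * -(103 / 50 * t * d2) ≤ D * (A - z) := mul_le_mul_of_nonneg_left hAz.1 hD.le
  have hDz : 0 ≤ D * z := mul_nonneg hD.le (hd.le.trans hz)
  -- the three factors
  have f1 : |D * (A - B)| ≤ D * (103 / 25 * t * d2) := by
    rw [abs_mul, abs_of_pos hD]
    refine mul_le_mul_of_nonneg_left ?_ hD.le
    rw [abs_le]; constructor <;> linarith [hAz.1, hAz.2, hBz.1, hBz.2]
  have f2 : |Q * P - Q ^ 2| ≤ D * (103 / 50 * t * d2 + 24 * t ^ 2 * d2) := by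
    have e : Q * P - Q ^ 2 = D * (A - z) - (D * A - Q * P) + (D * z - Q ^ 2) := by ring
    rw [e, abs_le]
    constructor <;> linarith [he1'.1, he1'.2]
  have f3 : |Q * P| ≤ D * (z + 103 / 50 * t * d2 + 15 * t ^ 2 * d2) := by
    have e : Q * P = D * z + D * (A - z) - (D * A - Q * P) := by ring
    rw [e, abs_le]
    constructor <;> linarith [he1'.1, he1'.2]
  have f5 : |Q ^ 2| = Q ^ 2 := abs_of_pos hQpos
  -- the sum
  have hsum : |Q ^ 2 * D * (pp - g - A + B)| ≤
      D * (103 / 25 * t * d2) * (D * (103 / 50 * t * d2 + 24 * t ^ 2 * d2)) +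
        D * (z + 103 / 50 * t * d2 + 15 * t ^ 2 * d2) * (9 * t ^ 2 * d2 * D) + Q ^ 2 * (15 * t ^ 2 * d2 * D) := by
    rw [hid]
    refine (abs_add_three _ _ _).trans (add_le_add (add_le_add ?_ ?_) ?_)
    · rw [abs_mul]; exact mul_le_mul f1 f2 (abs_nonneg _) ((abs_nonneg _).trans f1)
    · rw [abs_mul]; exact mul_le_mul f3 he21 (abs_nonneg _) ((abs_nonneg _).trans f3)
    · rw [abs_mul, f5]; exact mul_le_mul_of_nonneg_left he53 hQpos.le
  -- numerics: the first two terms are `≤ D²·(2/5·t·d2 − 15t²·d2)·(z − 9t²·d2) ≤ D·(2/5·t·d2 − 15t²·d2)·Q²`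
  have hnum : (103 / 25 * t * d2) * (103 / 50 * t * d2 + 24 * t ^ 2 * d2) +
      (z + 103 / 50 * t * d2 + 15 * t ^ 2 * d2) * (9 * t ^ 2 * d2) ≤ (2 / 5 * t * d2 - 15 * t ^ 2 * d2) * (z - 9 * t ^ 2 * d2) := by
    have e : (2 / 5 * t * d2 - 15 * t ^ 2 * d2) * (z - 9 * t ^ 2 * d2) -
        ((103 / 25 * t * d2) * (103 / 50 * t * d2 + 24 * t ^ 2 * d2) +
          (z + 103 / 50 * t * d2 + 15 * t ^ 2 * d2) * (9 * t ^ 2 * d2)) =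
        t * d2 * ((2 / 5 - 24 * t) * z - (10609 / 1250 * t + 6051 / 50 * t ^ 2) * d2) := by ring
    have h3 : 0 ≤ 2 / 5 - 24 * t - 10609 / 1250 * t - 6051 / 50 * t ^ 2 := by linarith
    have p1 : 0 ≤ (2 / 5 - 24 * t) * (z - d2) := mul_nonneg (by linarith) (by linarith)
    have p2 : 0 ≤ d2 * (2 / 5 - 24 * t - 10609 / 1250 * t - 6051 / 50 * t ^ 2) := mul_nonneg hd.le h3
    have h1 : 0 ≤ (2 / 5 - 24 * t) * z - (10609 / 1250 * t + 6051 / 50 * t ^ 2) * d2 := by linarith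
    have p3 : 0 ≤ t * d2 * ((2 / 5 - 24 * t) * z - (10609 / 1250 * t + 6051 / 50 * t ^ 2) * d2) := mul_nonneg htd.le h1
    linarith
  have hcoef : 0 ≤ 2 / 5 * t * d2 - 15 * t ^ 2 * d2 := by linarith
  have hmain : |Q ^ 2 * D * (pp - g - A + B)| ≤ (2 / 5 * t * d2) * (Q ^ 2 * D) := by
    refine hsum.trans ?_
    have h1 := mul_le_mul_of_nonneg_left hnum (mul_pos hD hD).le
    have h2 := mul_le_mul_of_nonneg_left (mul_le_mul_of_nonneg_left hQ2 hcoef) hD.le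
    linarith
  rw [abs_mul, abs_mul, f5, abs_of_pos hD] at hmain
  have hQD : 0 < Q ^ 2 * D := mul_pos hQpos hD
  have : |pp - g - A + B| * (Q ^ 2 * D) ≤ 2 / 5 * t * d2 * (Q ^ 2 * D) := by
    calc |pp - g - A + B| * (Q ^ 2 * D) = Q ^ 2 * D * |pp - g - A + B| := by ring
      _ ≤ 2 / 5 * t * d2 * (Q ^ 2 * D) := hmain
  exact le_of_mul_le_mul_right this hQD

/-- Squared window: `0 ≤ a ≤ x ≤ (1+t)·a ⟹ a² ≤ x² ≤ a² + ((1+t)² − 1)·a²`. [folklore] -/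
theorem sq_win {a x t : ℝ} (ha : 0 ≤ a) (h1 : a ≤ x) (h2 : x ≤ (1 + t) * a) :
    a ^ 2 ≤ x ^ 2 ∧ x ^ 2 ≤ a ^ 2 + ((1 + t) ^ 2 - 1) * a ^ 2 := by
  refine ⟨pow_le_pow_left₀ ha h1 2, ?_⟩
  have h3 : x ^ 2 ≤ ((1 + t) * a) ^ 2 := pow_le_pow_left₀ (ha.trans h1) h2 2
  have h4 : ((1 + t) * a) ^ 2 = a ^ 2 + ((1 + t) ^ 2 - 1) * a ^ 2 := by ring
  linarith

/-- Window width: `0 < t ≤ 1/100`, `0 ≤ a ≤ (1+t)·d` ⟹ `((1+t)² − 1)·a² ≤ (103/50)·t·d²`. [folklore] -/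
theorem excess_le {t a d : ℝ} (ht0 : 0 < t) (ht : t ≤ 1 / 100) (ha : 0 ≤ a) (h : a ≤ (1 + t) * d) :
    ((1 + t) ^ 2 - 1) * a ^ 2 ≤ 103 / 50 * t * d ^ 2 := by
  have h1 : a ^ 2 ≤ ((1 + t) * d) ^ 2 := pow_le_pow_left₀ ha h 2
  have h2 : 0 ≤ (1 + t) ^ 2 - 1 := by linarith [sq_nonneg t]
  have ht2 : t ^ 2 ≤ 1 / 100 * t := by rw [pow_two]; linarith [mul_le_mul_of_nonneg_left ht ht0.le]
  have ht3 : t ^ 3 ≤ t ^ 2 := by rw [pow_succ]; exact mul_le_of_le_one_right (sq_nonneg t) (by linarith)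
  calc ((1 + t) ^ 2 - 1) * a ^ 2 ≤ ((1 + t) ^ 2 - 1) * ((1 + t) * d) ^ 2 := mul_le_mul_of_nonneg_left h1 h2
    _ = ((2 + t) * (1 + t) ^ 2) * t * d ^ 2 := by ring
    _ ≤ 103 / 50 * t * d ^ 2 := by
        apply mul_le_mul_of_nonneg_right _ (sq_nonneg d)
        apply mul_le_mul_of_nonneg_right _ ht0.le
        linarith

/-! ## §3 Numerics at `0 < t ≤ 1/100` (with `s = nn_O²`, `K = (103/50)·t·s`, `L = s − K`) -/

/-- Side conditions of `inplane_le` for `A = 9t²s`, `a = a' = K` (used for the cap `q` and for `p − ρ`). -/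
theorem num_q {t s : ℝ} (ht : t ≤ 1 / 100) :
    (103 / 50 * t * s) ^ 2 ≤ 9 * t ^ 2 * s * (s - 103 / 50 * t * s) ∧
    (103 / 50 * t * s * (103 / 50 * t * s) + 9 * t ^ 2 * s * (103 / 50 * t * s)) ^ 2 ≤
      (9 * t ^ 2 * s * (s - 103 / 50 * t * s) - (103 / 50 * t * s) ^ 2) *
        (9 * t ^ 2 * s * (s - 103 / 50 * t * s) - (103 / 50 * t * s) ^ 2) := by
  have h1 : 0 ≤ t ^ 2 * s ^ 2 * (11891 / 2500 - 927 / 50 * t) := mul_nonneg (by positivity) (by linarith)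
  have h2 : 0 ≤ t ^ 4 * s ^ 4 * (5769 / 1250 - 8343 / 25 * t) := mul_nonneg (by positivity) (by linarith)
  exact ⟨by linarith, by linarith⟩

/-- Side conditions of `inplane_le` for `A = 23t²s`, `a = K`, `a' = 2K` (used for `p = b + b'`). -/
theorem num_p {t s : ℝ} (ht : t ≤ 1 / 100) :
    (103 / 50 * t * s) ^ 2 ≤ 23 * t ^ 2 * s * (s - 103 / 50 * t * s) ∧
    (2 * (103 / 50 * t * s)) ^ 2 ≤ 23 * t ^ 2 * s * (s - 103 / 50 * t * s) ∧
    (103 / 50 * t * s * (2 * (103 / 50 * t * s)) + 23 * t ^ 2 * s * (103 / 50 * t * s)) ^ 2 ≤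
      (23 * t ^ 2 * s * (s - 103 / 50 * t * s) - (103 / 50 * t * s) ^ 2) *
        (23 * t ^ 2 * s * (s - 103 / 50 * t * s) - (2 * (103 / 50 * t * s)) ^ 2) := by
  have h1 : 0 ≤ t ^ 2 * s ^ 2 * (46891 / 2500 - 2369 / 50 * t) := mul_nonneg (by positivity) (by linarith)
  have h2 : 0 ≤ t ^ 2 * s ^ 2 * (3766 / 625 - 2369 / 50 * t) := mul_nonneg (by positivity) (by linarith)
  have h3 : 0 ≤ t ^ 4 * s ^ 4 * (20493 / 500 - 247302279 / 125000 * t) := mul_nonneg (by positivity) (by linarith)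
  exact ⟨by linarith, by linarith, by linarith⟩

end Summit.AtomisticToContinuum.Crystallization.Theorems.FrustratedLawDichotomyTwoShellRigidityCapBrace

end
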